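import Literature.NumberTheory.LFunctions.ShiftedZetaPowerProducts
import Literature.Analysis.Complex.RectangleSlitContour
import Literature.Analysis.Asymptotics.LaplaceEndpointAlgebraic
import Literature.Barriers.RiemannHypothesis.TuranPartialSumsMontgomeryPerron
import Literature.Barriers.RiemannHypothesis.TuranPartialSumsBohr
import HarnessLib

/-!
# Montgomery 1983, §4 for a twist with finitely many singularities: the contour decomposition of `F_N(s₀) − F(s₀)`

Barrier catalogue `Literature/Barriers/RiemannHypothesis/`, proofs and auxiliary definitions only (no
named facts), companion of `TuranPartialSums.lean` (named fact `Montgomery1983_theorem`, Montgomery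
1983, Theorem p. 497, already reduced by Bohr's transfer to twisted zeros:
`Montgomery1983_theorem_of_twisted_zeros`, `TuranPartialSumsBohr.lean`).

Setting (`EulerTwistData`): a completely multiplicative `f` with `‖f‖ ≤ 1` whose prime sum splits on
`Re s > 1` as `Σ_p f(p)p^{−s} = Σ_{n ∈ S} μ_n Σ_p p^{in−s} + A(s)` with `S ⊆ ℤ` FINITE, real exponents
`|μ_n| < 1` and `A` holomorphic on `Re s > 0`, of logarithmic growth in the classical region (the
Fejér-dithered twist of `TuranPartialSumsDitheredTwist.lean`/`…DitheredProfile.lean` is such a datum).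
Then `F(s) = Σ f(n)n^{−s}` continues as `G(s) = Π_{n ∈ S} ζ(s − in)^{μ_n} e^{E(s)}`
(`Literature/NumberTheory/LFunctions/ShiftedZetaPowerProducts.lean`) to the classical zero-free
region slit along the horizontal half-lines ending at the branch points `1 + in`.

Montgomery (§4, (20)–(21)): "By (5) we see that
`F_N(s) = f(s) + (1/2πi)∫_{α−iK}^{α+iK} f(s+w)N^w dw/w + O(…)` … We replace the path of integration
by a new path … loops `Γ_k` … (21)". This file carries out exactly this bookkeeping for the datum
above, at half-integers `x = N + 1/2`, with the parameters
`L' = log x`, `T = L'^3`, `σ_R = 1 + 1/L'`, `Y = T + K + 4` (`K = max_{n ∈ S}|n|`),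
`σ_L = 1 − 4c̄/log Y` (inside the region up to height `T + 1`), for `s₀` to the right of `σ_R` with
`|Im s₀| < 1`:

* `EulerTwistData.norm_right_add_le` — the truncated Perron formula of
  `TuranPartialSumsMontgomeryPerron.lean` rewritten as
  `‖right + 2π(F(s₀) − F_N(s₀))‖ ≤ x^{σ_R−σ₀}(2/T)(6(1 + log(N+1)) + 2(L'+1))`, `right` the integral of
  `g(s) = G(s) x^{s−s₀}/(s−s₀)` up the right edge of `R = [σ_L, σ_R] × [t₀ − T, t₀ + T]`;
* `EulerTwistData.rectBoundaryIntegral_eq_sum_cut` — `∮_{∂R} g = Σ_{n ∈ S} cut_n`, the contour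
  collapsed onto the two rims of each slit (`Literature/Analysis/Complex/RectangleSlitContour.lean`,
  with the boundary values `ζ(s)^μ → e^{∓iπμ}(1−x)^{−μ}‖ζ₁(x)‖^μ` of `LogZetaClassicalRegion.lean`);
* `EulerTwistData.cut_eq` — each rim difference is a Laplace integral with an algebraic endpoint:
  `cut_n = 2i sin(πμ_n) x^{1+in−s₀} ∫_0^ℓ u^{−μ_n} e^{−L'u} q_n(u) du`,
  `q_n(u) = ‖ζ₁(1−u)‖^{μ_n} H_n(1−u+in)/(1−u+in−s₀)`, `ℓ = 1 − σ_L` (ready for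
  `Literature/Analysis/Asymptotics/LaplaceEndpointAlgebraic.lean`, Montgomery's (22)–(23));
* `EulerTwistData.norm_sub_decomposition_le` — **the exact decomposition**
  `F_N(s₀) − F(s₀) = (1/2π)(−i Σ_n cut_n + i·bottom − i·top + left) + O(x^{σ_R−σ₀} L'/T)`;
* `EulerTwistData.norm_G_le` — the size of `G` in the region:
  `‖G(s)‖ ≤ (C Λ + 1/η)^{Σ|μ_n|} exp(c_E + 6 log log(2|t|+6) + C_A)` whenever
  `log(|t − n| + 3) ≤ Λ` and `‖s − 1 − in‖ ≥ η` for all `n ∈ S`.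

The estimates of the pieces (Montgomery's (22)–(24)) are in the sequel
`TuranPartialSumsDitheredAsymptotic.lean`.

## References

* [Montgomery1983] H. L. Montgomery, *Zeros of approximations to the zeta function*, in: Studies in
  Pure Mathematics to the memory of Paul Turán, Birkhäuser 1983, 497–506: §2 (5), §4 (20)–(23).
* [Tenenbaum2015] G. Tenenbaum, *Introduction to analytic and probabilistic number theory*, 3rd ed.,
  AMS GSM 163, II.5 §5.2 (the same contour in the Selberg–Delange method).
-/

noncomputable section

open Complex Set MeasureTheory Filter Topology intervalIntegral
open Literature.NumberTheory.LFunctions Literature.Analysis.Complex Literature.Analysis.Asymptotics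

namespace Literature.Barriers.RiemannHypothesis

/-! ## The datum: an Euler product with finitely many shifted zeta-power singularities -/

/-- **A twist with finitely many singularities.** A completely multiplicative `f : ℕ →*₀ ℂ` with
`‖f‖ ≤ 1` whose prime sum splits on `Re s > 1` as `Σ_p f(p) p^{−s} = Σ_{n ∈ S} μ_n Σ_p p^{in−s} + A(s)`,
`S ⊆ ℤ` finite containing `1`, `|μ_n| < 1`, `A` holomorphic on `Re s > 0` with
`‖A(s)‖ ≤ 6 log log(2|t| + 6) + C_A` for `1/2 ≤ σ ≤ 2`, `σ ≥ 1 − 1/log(|t| + 3)`.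
[cite: Montgomery1983, §3 (14)–(16)] -/
structure EulerTwistData where
  /-- the completely multiplicative coefficients -/
  f : ℕ →*₀ ℂ
  /-- the finite set of frequencies -/
  S : Finset ℤ
  /-- the real exponents -/
  μ : ℤ → ℝ
  /-- the regular part of the prime sum -/
  A : ℂ → ℂ
  /-- the additive constant in the bound for `A` -/
  CA : ℝ
  norm_f_le : ∀ n, ‖f n‖ ≤ 1
  one_mem : (1 : ℤ) ∈ S
  abs_μ_lt_one : ∀ n, |μ n| < 1
  differentiableOn_A : DifferentiableOn ℂ A {s : ℂ | 0 < s.re}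
  norm_A_le : ∀ s : ℂ, 1 / 2 ≤ s.re → s.re ≤ 2 → 1 - 1 / Real.log (|s.im| + 3) ≤ s.re →
    ‖A s‖ ≤ 6 * Real.log (Real.log (2 * |s.im| + 6)) + CA
  split : ∀ s : ℂ, 1 < s.re → (∑' p : Nat.Primes, f p * (p : ℂ) ^ (-s)) =
    (∑ n ∈ S, (μ n : ℂ) * ∑' p : Nat.Primes, (p : ℂ) ^ (-(s - n * I))) + A s

/-! ## The parameters attached to `x = N + 1/2` -/

namespace DitheredContour

/-- `x = N + 1/2`. [cite: Montgomery1983, §4 (20)] -/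
def xN (N : ℕ) : ℝ := (N : ℝ) + 1 / 2

/-- `L' = log x`. [cite: Montgomery1983, §4] -/
def L (N : ℕ) : ℝ := Real.log (xN N)

/-- The truncation height `T = L'^3`. [cite: Montgomery1983, §4 (20) (there K = exp((log log N)²))] -/
def T (N : ℕ) : ℝ := L N ^ 3

/-- The abscissa of the Perron line `σ_R = 1 + 1/L'`. [cite: Montgomery1983, §2 (5)] -/
def σR (N : ℕ) : ℝ := 1 + 1 / L N

/-- The half-width `r = 1/(2L')` of the thin boxes around the slits. [folklore] -/
def r (N : ℕ) : ℝ := 1 / (2 * L N)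

/-- `Y = T + K + 4`, a bound for `|t| + 3` on the contour. [folklore] -/
def Y (K N : ℕ) : ℝ := T N + K + 4

/-- The depth `ℓ = 4c̄/log Y` of the contour inside the critical strip. [cite: Montgomery1983, §4 (γ)] -/
def ℓ (K N : ℕ) : ℝ := 4 * zfrConst / Real.log (Y K N)

/-- The left abscissa `σ_L = 1 − ℓ`. [cite: Montgomery1983, §4 (γ = 1 − σ − c₁/(3 log K))] -/
def σL (K N : ℕ) : ℝ := 1 - ℓ K N

/-- Auxiliary step `xN_pos` (see the module docstring). [folklore] -/
theorem xN_pos (N : ℕ) : 0 < xN N := by unfold xN; positivity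

/-- Auxiliary step `xN_ne_zero` (see the module docstring). [folklore] -/
theorem xN_ne_zero (N : ℕ) : (xN N : ℂ) ≠ 0 := ofReal_ne_zero.2 (xN_pos N).ne'

variable {K N : ℕ}

/-- Auxiliary step `T_pos` (see the module docstring). [folklore] -/
theorem T_pos (hL : 1 ≤ L N) : 0 < T N := by unfold T; positivity

/-- Auxiliary step `one_le_T` (see the module docstring). [folklore] -/
theorem one_le_T (hL : 1 ≤ L N) : 1 ≤ T N := by
  unfold T; exact one_le_pow₀ hL

/-- Auxiliary step `σR_eq` (see the module docstring). [folklore] -/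
theorem σR_eq (N : ℕ) : σR N = 1 + 1 / L N := rfl

/-- Auxiliary step `one_lt_σR` (see the module docstring). [folklore] -/
theorem one_lt_σR (hL : 1 ≤ L N) : 1 < σR N := by
  unfold σR; have : 0 < 1 / L N := by positivity
  linarith

/-- Auxiliary step `σR_le_two` (see the module docstring). [folklore] -/
theorem σR_le_two (hL : 1 ≤ L N) : σR N ≤ 2 := by
  unfold σR
  have : 1 / L N ≤ 1 := by rw [div_le_one (by linarith)]; exact hL
  linarith

/-- Auxiliary step `r_pos` (see the module docstring). [folklore] -/
theorem r_pos (hL : 1 ≤ L N) : 0 < r N := by unfold r; positivity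

/-- Auxiliary step `r_le_half` (see the module docstring). [folklore] -/
theorem r_le_half (hL : 1 ≤ L N) : r N ≤ 1 / 2 := by
  unfold r
  rw [div_le_div_iff₀ (by positivity) (by norm_num)]
  linarith

/-- Auxiliary step `one_add_r_lt_σR` (see the module docstring). [folklore] -/
theorem one_add_r_lt_σR (hL : 1 ≤ L N) : 1 + r N < σR N := by
  unfold r σR
  have hL0 : 0 < L N := by linarith
  have : 1 / (2 * L N) < 1 / L N := by
    rw [div_lt_div_iff₀ (by positivity) hL0]; linarith
  linarith

/-- Auxiliary step `five_le_Y` (see the module docstring). [folklore] -/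
theorem five_le_Y (hL : 1 ≤ L N) : 5 ≤ Y K N := by
  unfold Y
  have := one_le_T hL
  have : (0 : ℝ) ≤ K := Nat.cast_nonneg K
  linarith

/-- Auxiliary step `one_lt_log_Y` (see the module docstring). [folklore] -/
theorem one_lt_log_Y (hL : 1 ≤ L N) : 1 < Real.log (Y K N) := by
  have h5 := five_le_Y (K := K) hL
  have : Real.exp 1 < Y K N := lt_of_lt_of_le (by have := Real.exp_one_lt_d9; norm_num at this ⊢; linarith) h5
  rwa [Real.lt_log_iff_exp_lt (by linarith)]

/-- Auxiliary step `log_Y_pos` (see the module docstring). [folklore] -/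
theorem log_Y_pos (hL : 1 ≤ L N) : 0 < Real.log (Y K N) := lt_trans zero_lt_one (one_lt_log_Y hL)

/-- Auxiliary step `ℓ_pos` (see the module docstring). [folklore] -/
theorem ℓ_pos (hL : 1 ≤ L N) : 0 < ℓ K N :=
  div_pos (mul_pos four_pos zfrConst_pos) (log_Y_pos hL)

/-- `ℓ ≤ 4c̄ ≤ 1/25`. [folklore] -/
theorem ℓ_le (hL : 1 ≤ L N) : ℓ K N ≤ 1 / 25 := by
  unfold ℓ
  have h1 := one_lt_log_Y (K := K) hL
  have h2 : 4 * zfrConst / Real.log (Y K N) ≤ 4 * zfrConst := by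
    rw [div_le_iff₀ (by linarith)]; nlinarith [zfrConst_pos]
  linarith [zfrConst_le]

/-- Auxiliary step `σL_lt_one` (see the module docstring). [folklore] -/
theorem σL_lt_one (hL : 1 ≤ L N) : σL K N < 1 := by
  unfold σL; linarith [ℓ_pos (K := K) hL]

/-- Auxiliary step `σL_ge` (see the module docstring). [folklore] -/
theorem σL_ge (hL : 1 ≤ L N) : 24 / 25 ≤ σL K N := by
  unfold σL; linarith [ℓ_le (K := K) hL]

/-- Auxiliary step `one_sub_σL` (see the module docstring). [folklore] -/
theorem one_sub_σL : 1 - σL K N = ℓ K N := by unfold σL; ring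

/-- Points with `Re w ≥ σ_L` and `|Im w| + 3 < Y` lie in the classical region. [folklore] -/
theorem mem_zfrRegion_of_σL_le {w : ℂ} (hre : σL K N ≤ w.re)
    (him : |w.im| + 3 < Y K N) : w ∈ zfrRegion := by
  rw [mem_zfrRegion]
  have h3 : 1 < |w.im| + 3 := by linarith [abs_nonneg w.im]
  have hlog : Real.log (|w.im| + 3) < Real.log (Y K N) := Real.log_lt_log (by linarith) him
  have hlog0 : 0 < Real.log (|w.im| + 3) := Real.log_pos h3
  have hlt : ℓ K N < zfrWidth w.im := by
    unfold ℓ zfrWidth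
    exact div_lt_div_of_pos_left (mul_pos four_pos zfrConst_pos) hlog0 hlog
  unfold σL at hre
  linarith

/-- On such points the logarithmic condition `1 − 1/log(|t|+3) ≤ σ` of the bound for `A` holds.
[folklore] -/
theorem one_sub_inv_log_le {w : ℂ} (hre : σL K N ≤ w.re)
    (him : |w.im| + 3 ≤ Y K N) : 1 - 1 / Real.log (|w.im| + 3) ≤ w.re := by
  have h3 : 1 < |w.im| + 3 := by linarith [abs_nonneg w.im]
  have hlog0 : 0 < Real.log (|w.im| + 3) := Real.log_pos h3
  have hlog : Real.log (|w.im| + 3) ≤ Real.log (Y K N) := Real.log_le_log (by linarith) him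
  -- `ℓ = 4c̄/log Y ≤ (1/25)/log(|t|+3) ≤ 1/log(|t|+3)`
  have h1 : ℓ K N ≤ 1 / Real.log (|w.im| + 3) := by
    unfold ℓ
    calc 4 * zfrConst / Real.log (Y K N) ≤ 4 * zfrConst / Real.log (|w.im| + 3) :=
          div_le_div_of_nonneg_left (mul_pos four_pos zfrConst_pos).le hlog0 hlog
      _ ≤ 1 / Real.log (|w.im| + 3) :=
          div_le_div_of_nonneg_right (by linarith [zfrConst_le]) hlog0.le
  unfold σL at hre
  linarith

end DitheredContour

open DitheredContour

/-! ## Elementary consequences of the datum -/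

namespace EulerTwistData

variable (D : EulerTwistData)

/-- The continuation `G = Π_n ζ(s − in)^{μ_n} e^{E}` of `Σ f(n) n^{−s}`.
[cite: Montgomery1983, §3 (21)] -/
def G : ℂ → ℂ := eulerContinuation D.S D.μ D.f D.A

/-- The cofactor `H_k` of the `k`-th singularity. [cite: Montgomery1983, §4 (the loops Γ_k)] -/
def H (k : ℤ) : ℂ → ℂ := cofactor D.S D.μ D.f D.A k

/-- `K = max_{n ∈ S} |n|`. [folklore] -/
def K : ℕ := D.S.sup fun n : ℤ ↦ n.natAbs

/-- The total exponent `P = Σ_{n ∈ S} |μ_n|`. [folklore] -/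
def P : ℝ := ∑ n ∈ D.S, |D.μ n|

/-- The largest non-negative exponent `μ̄ = max_{n ∈ S} μ_n⁺ < 1`. [folklore] -/
def μbar : ℝ := D.S.sup' ⟨1, D.one_mem⟩ fun n ↦ max (D.μ n) 0

/-- Auxiliary step `natAbs_le_K` (see the module docstring). [folklore] -/
theorem natAbs_le_K {n : ℤ} (hn : n ∈ D.S) : n.natAbs ≤ D.K :=
  Finset.le_sup (f := fun n : ℤ ↦ n.natAbs) hn

/-- Auxiliary step `abs_intCast_le_K` (see the module docstring). [folklore] -/
theorem abs_intCast_le_K {n : ℤ} (hn : n ∈ D.S) : |(n : ℝ)| ≤ D.K := by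
  have h := D.natAbs_le_K hn
  have h1 : |(n : ℝ)| = ((n.natAbs : ℤ) : ℝ) := by
    rw [Int.natCast_natAbs, Int.cast_abs]
  rw [h1, Int.cast_natCast]
  exact_mod_cast h

/-- Auxiliary step `μbar_lt_one` (see the module docstring). [folklore] -/
theorem μbar_lt_one : D.μbar < 1 := by
  rw [μbar, Finset.sup'_lt_iff]
  intro n _
  exact max_lt (abs_lt.1 (D.abs_μ_lt_one n)).2 one_pos

/-- Auxiliary step `μbar_nonneg` (see the module docstring). [folklore] -/
theorem μbar_nonneg : 0 ≤ D.μbar :=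
  le_trans (le_max_right _ _) (Finset.le_sup' (fun n ↦ max (D.μ n) 0) D.one_mem)

/-- Auxiliary step `le_μbar` (see the module docstring). [folklore] -/
theorem le_μbar {n : ℤ} (hn : n ∈ D.S) : D.μ n ≤ D.μbar :=
  le_trans (le_max_left _ _) (Finset.le_sup' (fun n ↦ max (D.μ n) 0) hn)

/-- Auxiliary step `P_nonneg` (see the module docstring). [folklore] -/
theorem P_nonneg : 0 ≤ D.P := Finset.sum_nonneg fun _ _ ↦ abs_nonneg _

/-- Auxiliary step `abs_μ_le_one` (see the module docstring). [folklore] -/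
theorem abs_μ_le_one (n : ℤ) : |D.μ n| ≤ 1 := (D.abs_μ_lt_one n).le

/-- Auxiliary step `μ_lt_one` (see the module docstring). [folklore] -/
theorem μ_lt_one (n : ℤ) : D.μ n < 1 := (abs_lt.1 (D.abs_μ_lt_one n)).2

/-- `F = G` on `Re s > 1`. [cite: Montgomery1983, §3 (21)] -/
theorem LSeries_eq_G {s : ℂ} (hs : 1 < s.re) : LSeries (D.f ·) s = D.G s :=
  LSeries_eq_eulerContinuation D.norm_f_le D.split hs

/-- `G = ζ(s − ik)^{μ_k} H_k` for `k ∈ S`. [folklore] -/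
theorem G_eq_zetaCpow_mul_H {k : ℤ} (hk : k ∈ D.S) (s : ℂ) :
    D.G s = zetaCpow (D.μ k) (s - k * I) * D.H k s :=
  eulerContinuation_eq_zetaCpow_mul_cofactor hk s

/-- `G` is holomorphic on `shiftedSlitDomain S ∩ {Re s > 3/4}`. [folklore] -/
theorem differentiableOn_G :
    DifferentiableOn ℂ D.G (shiftedSlitDomain D.S ∩ {s : ℂ | 3 / 4 < s.re}) := by
  have h := differentiableOn_eulerContinuation (S := D.S) (μ := D.μ) D.norm_f_le D.differentiableOn_A
  refine h.mono fun s hs ↦ ⟨hs.1, hs.2, ?_⟩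
  show 0 < s.re
  have : 3 / 4 < s.re := hs.2
  linarith

/-- The domain of the cofactor `H_k` is open. [folklore] -/
theorem isOpen_cofactorDomain (k : ℤ) :
    IsOpen ({s : ℂ | ∀ n ∈ D.S, n ≠ k → s - n * I ∈ zfrSlitRegion} ∩
      ({s : ℂ | 3 / 4 < s.re} ∩ {s : ℂ | (0 : ℝ) < s.re})) := by
  have h1 : {s : ℂ | ∀ n ∈ D.S, n ≠ k → s - n * I ∈ zfrSlitRegion} =
      ⋂ n ∈ D.S.erase k, (fun s : ℂ ↦ s - n * I) ⁻¹' zfrSlitRegion := by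
    ext s
    simp only [mem_setOf_eq, mem_iInter, mem_preimage, Finset.mem_erase]
    exact ⟨fun h n hn ↦ h n hn.2 hn.1, fun h n hn hnk ↦ h n ⟨hnk, hn⟩⟩
  rw [h1]
  exact (isOpen_biInter_finset fun n _ ↦ isOpen_zfrSlitRegion.preimage (by fun_prop)).inter
    ((isOpen_lt continuous_const continuous_re).inter (isOpen_lt continuous_const continuous_re))

/-- `H_k` is differentiable at every point of its (open) domain. [folklore] -/
theorem differentiableAt_H {k : ℤ} {s : ℂ} (hs : ∀ n ∈ D.S, n ≠ k → s - n * I ∈ zfrSlitRegion)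
    (h34 : 3 / 4 < s.re) : DifferentiableAt ℂ (D.H k) s := by
  have h := differentiableOn_cofactor (S := D.S) (μ := D.μ) D.norm_f_le D.differentiableOn_A k
  exact h.differentiableAt ((D.isOpen_cofactorDomain k).mem_nhds ⟨hs, h34, by show (0:ℝ) < s.re; linarith⟩)

/-- Auxiliary step `continuousAt_H` (see the module docstring). [folklore] -/
theorem continuousAt_H {k : ℤ} {s : ℂ} (hs : ∀ n ∈ D.S, n ≠ k → s - n * I ∈ zfrSlitRegion)
    (h34 : 3 / 4 < s.re) : ContinuousAt (D.H k) s :=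
  (D.differentiableAt_H hs h34).continuousAt

/-! ## The kernel `x^{s−s₀}/(s−s₀)` and the integrand `g` -/

/-- Perron's kernel seen from `s₀`: `k(s) = x^{s−s₀}/(s − s₀)`. [cite: Montgomery1983, §2 (3)] -/
def kernel (N : ℕ) (s₀ s : ℂ) : ℂ := (xN N : ℂ) ^ (s - s₀) / (s - s₀)

/-- The integrand `g(s) = G(s) x^{s−s₀}/(s−s₀)`. [cite: Montgomery1983, §4 (20)] -/
def g (N : ℕ) (s₀ s : ℂ) : ℂ := D.G s * kernel N s₀ s

/-- Auxiliary step `differentiableAt_kernel` (see the module docstring). [folklore] -/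
theorem differentiableAt_kernel {N : ℕ} {s₀ s : ℂ} (hs : s ≠ s₀) :
    DifferentiableAt ℂ (kernel N s₀) s := by
  unfold kernel
  have h1 : DifferentiableAt ℂ (fun s : ℂ ↦ (xN N : ℂ) ^ (s - s₀)) s :=
    (differentiableAt_id.sub_const s₀).const_cpow (Or.inl (xN_ne_zero N))
  exact h1.div (differentiableAt_id.sub_const s₀) (sub_ne_zero.2 hs)

/-- Auxiliary step `continuousAt_kernel` (see the module docstring). [folklore] -/
theorem continuousAt_kernel {N : ℕ} {s₀ s : ℂ} (hs : s ≠ s₀) : ContinuousAt (kernel N s₀) s :=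
  (differentiableAt_kernel hs).continuousAt

/-- `‖k(s)‖ = x^{Re s − Re s₀}/‖s − s₀‖`. [folklore] -/
theorem norm_kernel (N : ℕ) (s₀ s : ℂ) :
    ‖kernel N s₀ s‖ = xN N ^ (s.re - s₀.re) / ‖s - s₀‖ := by
  rw [kernel, norm_div, norm_cpow_eq_rpow_re_of_pos (xN_pos N), sub_re]

/-! ## The geometry of the contour -/

section Geometry

variable {D}
variable {N : ℕ} {s₀ : ℂ}

/-- Points of the strip `|Im z − Im s₀| ≤ T`, `Re z ≥ σ_L` have all their shifts `z − in`, `n ∈ S`,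
in the classical region. [folklore] -/
theorem shift_mem_zfrRegion (ht₀ : |s₀.im| < 1) {z : ℂ} (hre : σL D.K N ≤ z.re)
    (him : |z.im - s₀.im| ≤ T N) {n : ℤ} (hn : n ∈ D.S) : z - n * I ∈ zfrRegion := by
  refine mem_zfrRegion_of_σL_le (K := D.K) (by simpa using hre) ?_
  have h1 : |(z - n * I).im| ≤ |z.im| + |(n : ℝ)| := by
    have : (z - n * I).im = z.im - n := by simp
    rw [this]
    exact abs_sub _ _
  have h2 : |z.im| < T N + 1 := by
    have := abs_sub_abs_le_abs_sub z.im s₀.im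
    linarith
  have h3 := D.abs_intCast_le_K hn
  unfold Y
  linarith

/-- … and `log(|Im z − n| + 3) ≤ log Y`. [folklore] -/
theorem log_shift_le (ht₀ : |s₀.im| < 1) {z : ℂ} (him : |z.im - s₀.im| ≤ T N)
    {n : ℤ} (hn : n ∈ D.S) : Real.log (|z.im - n| + 3) ≤ Real.log (Y D.K N) := by
  have h1 : |z.im - n| ≤ |z.im| + |(n : ℝ)| := abs_sub _ _
  have h2 : |z.im| < T N + 1 := by
    have := abs_sub_abs_le_abs_sub z.im s₀.im
    linarith
  have h3 := D.abs_intCast_le_K hn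
  refine Real.log_le_log (by linarith [abs_nonneg (z.im - n)]) ?_
  unfold Y; linarith

/-- The open set `U = {Re z < Re s₀} ∩ {Re z > 3/4} ∩ ⋂_n ({z − in ∈ Ω})` on which `g` is
holomorphic off the slits. [folklore] -/
def U (D : EulerTwistData) (s₀ : ℂ) : Set ℂ :=
  {z : ℂ | z.re < s₀.re} ∩ ({z : ℂ | 3 / 4 < z.re} ∩ {z : ℂ | ∀ n ∈ D.S, z - n * I ∈ zfrRegion})

/-- Auxiliary step `isOpen_U` (see the module docstring). [folklore] -/
theorem isOpen_U : IsOpen (U D s₀) := by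
  have h1 : {z : ℂ | ∀ n ∈ D.S, z - n * I ∈ zfrRegion} =
      ⋂ n ∈ D.S, (fun z : ℂ ↦ z - n * I) ⁻¹' zfrRegion := by
    ext z; simp
  refine (isOpen_lt continuous_re continuous_const).inter
    ((isOpen_lt continuous_const continuous_re).inter ?_)
  rw [h1]
  exact isOpen_biInter_finset fun n _ ↦ isOpen_zfrRegion.preimage (by fun_prop)

/-- The closed rectangle `[σ_L, σ_R] × [t₀ − T, t₀ + T]` lies in `U`. [folklore] -/
theorem rect_subset_U (hL : 1 ≤ L N) (hσ₀ : σR N < s₀.re) (ht₀ : |s₀.im| < 1) :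
    Icc (σL D.K N) (σR N) ×ℂ Icc (s₀.im - T N) (s₀.im + T N) ⊆ U D s₀ := by
  intro z hz
  rw [mem_reProdIm, mem_Icc, mem_Icc] at hz
  refine ⟨by show z.re < s₀.re; linarith [hz.1.2], by show 3 / 4 < z.re; linarith [hz.1.1, σL_ge (K := D.K) hL],
    fun n hn ↦ ?_⟩
  refine shift_mem_zfrRegion ht₀ hz.1.1 ?_ hn
  rw [abs_le]; constructor <;> linarith [hz.2.1, hz.2.2]

/-- `g` is holomorphic on `U` off the slits `{Im z = n, Re z ≤ 1}`, `n ∈ S`. [folklore] -/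
theorem differentiableOn_g :
    DifferentiableOn ℂ (D.g N s₀)
      (U D s₀ \ ⋃ h ∈ D.S.image (Int.cast : ℤ → ℝ), {z : ℂ | z.im = h ∧ z.re ≤ 1}) := by
  intro z hz
  obtain ⟨⟨hzre, hz34, hzreg⟩, hzslit⟩ := hz
  have hzre' : z.re < s₀.re := hzre
  have hz34' : 3 / 4 < z.re := hz34
  -- `z` lies in the slit domain
  have hslit : z ∈ shiftedSlitDomain D.S := by
    intro n hn
    refine ⟨hzreg n hn, ?_⟩
    show z - n * I - 1 ∈ slitPlane
    rw [mem_slitPlane_iff]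
    by_contra hcon
    push Not at hcon
    refine hzslit (mem_iUnion₂.2 ⟨(n : ℝ), Finset.mem_image_of_mem _ hn, ?_⟩)
    have h1 : (z - n * I - 1).im = z.im - n := by simp
    have h2 : (z - n * I - 1).re = z.re - 1 := by simp
    refine ⟨?_, ?_⟩
    · have := hcon.2; rw [h1] at this; linarith
    · have := hcon.1; rw [h2] at this; linarith
  have hG : DifferentiableAt ℂ D.G z :=
    D.differentiableOn_G.differentiableAt
      (((isOpen_shiftedSlitDomain D.S).inter (isOpen_lt continuous_const continuous_re)).mem_nhds
        ⟨hslit, hz34'⟩)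
  have hk : DifferentiableAt ℂ (kernel N s₀) z :=
    differentiableAt_kernel (fun h ↦ by rw [h] at hzre'; exact lt_irrefl _ hzre')
  exact (hG.mul hk).differentiableWithinAt

end Geometry

/-! ## The size of `G` in the region -/

/-- **The size of `G` in the region.** If every shift `s − in` (`n ∈ S`) lies in the classical region,
off `1`, with `log(|Im s − n| + 3) ≤ Λ` and `‖s − in − 1‖ ≥ η > 0`, and `3/4 ≤ σ ≤ 2`,
`σ ≥ 1 − 1/log(|t| + 3)`, then
`‖G(s)‖ ≤ (C Λ + 1/η)^{P} exp((1 + P) R* + 6 log log(2|t| + 6) + C_A)` (`C = zfrBoundConst`,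
`P = Σ|μ_n|`, `R* = logRemainderBound`). [cite: Montgomery1983, §3, Lemmas 2–4 ((17)–(19))] -/
theorem norm_G_le {s : ℂ} (hs : ∀ n ∈ D.S, s - n * I ∈ zfrRegion) (hs1 : ∀ n ∈ D.S, s - n * I ≠ 1)
    (h34 : 3 / 4 ≤ s.re) (h2 : s.re ≤ 2) (hσt : 1 - 1 / Real.log (|s.im| + 3) ≤ s.re)
    {Λ η : ℝ} (hΛ : ∀ n ∈ D.S, Real.log (|s.im - n| + 3) ≤ Λ) (hη : 0 < η)
    (hηs : ∀ n ∈ D.S, η ≤ ‖s - n * I - 1‖) :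
    ‖D.G s‖ ≤ (zfrBoundConst * Λ + 1 / η) ^ D.P *
      Real.exp ((1 + D.P) * logRemainderBound + (6 * Real.log (Real.log (2 * |s.im| + 6)) + D.CA)) := by
  have h0 := norm_eulerContinuation_le (S := D.S) (μ := D.μ) (A := D.A) D.norm_f_le h34 hs hs1
  have hA := D.norm_A_le s (by linarith) h2 hσt
  set B : ℝ := zfrBoundConst * Λ + 1 / η with hB
  have hΛ0 : 0 ≤ Λ := by
    have h1 := hΛ 1 D.one_mem
    have : 0 ≤ Real.log (|s.im - (1 : ℤ)| + 3) := Real.log_nonneg (by linarith [abs_nonneg (s.im - (1:ℤ))])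
    linarith
  have hB0 : 0 < B := by
    rw [hB]; have := zfrBoundConst_pos; positivity
  -- each factor
  have hfac : ∀ n ∈ D.S, ‖riemannZeta (s - n * I)‖ ^ D.μ n ≤ B ^ |D.μ n| := by
    intro n hn
    set w : ℂ := s - n * I with hw
    have hw1 : w ≠ 1 := hs1 n hn
    have hwr : w ∈ zfrRegion := hs n hn
    have him : w.im = s.im - n := by simp [hw]
    have hlogle : zfrBoundConst * Real.log (|w.im| + 3) ≤ zfrBoundConst * Λ := by
      rw [him]; exact mul_le_mul_of_nonneg_left (hΛ n hn) zfrBoundConst_pos.le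
    have hlog0 : 0 ≤ zfrBoundConst * Real.log (|w.im| + 3) :=
      mul_nonneg zfrBoundConst_pos.le (Real.log_nonneg (by linarith [abs_nonneg w.im]))
    rw [← norm_zetaCpow hwr hw1]
    rcases le_or_gt 0 (D.μ n) with hμ | hμ
    · rw [abs_of_nonneg hμ]
      refine (norm_zetaCpow_le_of_nonneg hμ hwr hw1).trans (Real.rpow_le_rpow (by positivity) ?_ hμ)
      have : 1 / ‖w - 1‖ ≤ 1 / η := div_le_div_of_nonneg_left zero_le_one hη (hηs n hn)
      rw [hB]; linarith
    · rw [abs_of_neg hμ]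
      refine (norm_zetaCpow_le_of_nonpos hμ.le hwr hw1).trans (Real.rpow_le_rpow hlog0 ?_ (by linarith))
      rw [hB]; linarith [(by positivity : 0 < 1 / η)]
  have hprod : ∏ n ∈ D.S, ‖riemannZeta (s - n * I)‖ ^ D.μ n ≤ B ^ D.P := by
    rw [P, Real.rpow_sum_of_pos hB0]
    exact Finset.prod_le_prod (fun n _ ↦ Real.rpow_nonneg (norm_nonneg _) _) hfac
  refine h0.trans (mul_le_mul hprod (Real.exp_le_exp.2 ?_) (Real.exp_pos _).le
    (Real.rpow_nonneg hB0.le _))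
  have hP : (1 + ∑ n ∈ D.S, |D.μ n|) * logRemainderBound = (1 + D.P) * logRemainderBound := rfl
  linarith

/-! ## Boundary values on the slits and the bound near the branch points -/

section Slits

variable {D}
variable {N : ℕ} {s₀ : ℂ}

/-- The boundary value of `g` from BELOW the slit at height `n`, at the point `x + in`, `x < 1`:
`e^{+iπμ_n} ‖ζ₁(x)‖^{μ_n} (1 − x)^{−μ_n} H_n(x + in) k(x + in)`. [cite: Tenenbaum2015, II.5 §5.1] -/
def bvLower (D : EulerTwistData) (N : ℕ) (s₀ : ℂ) (n : ℤ) (x : ℝ) : ℂ :=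
  (((‖riemannZeta₁ x‖ ^ (D.μ n) * (1 - x) ^ (-(D.μ n)) : ℝ) : ℂ) * exp ((Real.pi * D.μ n) * I)) *
    (D.H n (x + n * I) * kernel N s₀ (x + n * I))

/-- The boundary value of `g` from ABOVE the slit at height `n`:
`e^{−iπμ_n} ‖ζ₁(x)‖^{μ_n} (1 − x)^{−μ_n} H_n(x + in) k(x + in)`. [cite: Tenenbaum2015, II.5 §5.1] -/
def bvUpper (D : EulerTwistData) (N : ℕ) (s₀ : ℂ) (n : ℤ) (x : ℝ) : ℂ :=
  (((‖riemannZeta₁ x‖ ^ (D.μ n) * (1 - x) ^ (-(D.μ n)) : ℝ) : ℂ) * exp (-(Real.pi * D.μ n) * I)) *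
    (D.H n (x + n * I) * kernel N s₀ (x + n * I))

/-- The difference of the two rims: `∫_{σ_L}^{1} (g₋ − g₊)` along the slit at height `n`.
[cite: Montgomery1983, §4 (the loop Γ_k collapsed onto the cut)] -/
def cut (D : EulerTwistData) (N : ℕ) (s₀ : ℂ) (n : ℤ) : ℂ :=
  (∫ x in σL D.K N..1, bvLower D N s₀ n x) - ∫ x in σL D.K N..1, bvUpper D N s₀ n x

/-- Near the slit at height `k ∈ S` (within `|Im z − k| < 1`), the OTHER shifts are off their cuts.
[folklore] -/
theorem other_shifts_mem (ht₀ : |s₀.im| < 1) (hT : (D.K : ℝ) + 2 ≤ T N)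
    {k : ℤ} (hk : k ∈ D.S) {z : ℂ} (hre : σL D.K N ≤ z.re) (him : |z.im - k| < 1) :
    ∀ n ∈ D.S, n ≠ k → z - n * I ∈ zfrSlitRegion := by
  intro n hn hnk
  have hzT : |z.im - s₀.im| ≤ T N := by
    have h1 : |z.im - s₀.im| ≤ |z.im - k| + |(k : ℝ) - s₀.im| := abs_sub_le _ _ _
    have h2 : |(k : ℝ) - s₀.im| ≤ |(k : ℝ)| + |s₀.im| := abs_sub _ _
    have h3 := D.abs_intCast_le_K hk
    linarith
  refine mem_zfrSlitRegion_of_im_ne_zero (shift_mem_zfrRegion ht₀ hre hzT hn) ?_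
  have h1 : (z - n * I).im = z.im - n := by simp
  rw [h1]
  intro h0
  have hkn : (1 : ℝ) ≤ |(k : ℝ) - n| := by
    have : (1 : ℤ) ≤ |k - n| := Int.one_le_abs (sub_ne_zero.2 (Ne.symm hnk))
    have : ((1 : ℤ) : ℝ) ≤ ((|k - n| : ℤ) : ℝ) := by exact_mod_cast this
    simpa [Int.cast_abs] using this
  have h2 : |(k : ℝ) - n| ≤ |(k : ℝ) - z.im| + |z.im - n| := abs_sub_le _ _ _
  rw [h0, abs_zero, add_zero] at h2
  have h3 : |(k : ℝ) - z.im| = |z.im - k| := abs_sub_comm _ _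
  linarith

/-- **Boundary value from below.** [cite: Tenenbaum2015, II.5 §5.1] -/
theorem tendsto_g_lower (hL : 1 ≤ L N) (hσ₀ : σR N < s₀.re) (ht₀ : |s₀.im| < 1)
    (hT : (D.K : ℝ) + 2 ≤ T N) {n : ℤ} (hn : n ∈ D.S) {x : ℝ} (hx : x ∈ Ico (σL D.K N) 1) :
    Tendsto (D.g N s₀) (𝓝[{z : ℂ | z.im < n}] ((x : ℂ) + ((n : ℝ) : ℂ) * I))
      (𝓝 (bvLower D N s₀ n x)) := by
  rw [ofReal_intCast]
  have hxreg : (x : ℂ) ∈ zfrRegion :=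
    mem_zfrRegion_of_σL_le (K := D.K) (by simpa using hx.1)
      (by simp; linarith [five_le_Y (K := D.K) hL])
  -- the singular factor
  have hmap : Tendsto (fun z : ℂ ↦ z - n * I) (𝓝[{z : ℂ | z.im < n}] ((x : ℂ) + n * I))
      (𝓝[{s : ℂ | s.im < 0}] (x : ℂ)) := by
    refine tendsto_nhdsWithin_of_tendsto_nhds_of_eventually_within _ ?_ ?_
    · have hc : Continuous fun z : ℂ ↦ z - n * I := by fun_prop
      have := hc.tendsto ((x : ℂ) + n * I)
      rw [show (x : ℂ) + n * I - n * I = x by ring] at this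
      exact this.mono_left nhdsWithin_le_nhds
    · filter_upwards [self_mem_nhdsWithin] with z hz
      have hz' : z.im < n := hz
      show (z - n * I).im < 0
      simp; linarith
  have h1 := (tendsto_zetaCpow_lower (μ := D.μ n) hxreg hx.2).comp hmap
  -- the regular factor
  have hpt34 : 3 / 4 < ((x : ℂ) + n * I).re := by simp; linarith [hx.1, σL_ge (K := D.K) hL]
  have hother := other_shifts_mem ht₀ hT hn (z := (x : ℂ) + n * I) (by simpa using hx.1) (by simp)
  have hH : ContinuousAt (D.H n) ((x : ℂ) + n * I) := D.continuousAt_H hother hpt34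
  have hne : (x : ℂ) + n * I ≠ s₀ := by
    intro h
    have := congrArg Complex.re h
    simp at this
    linarith [hx.2, one_lt_σR hL]
  have hk : ContinuousAt (kernel N s₀) ((x : ℂ) + n * I) := continuousAt_kernel hne
  have h2 : Tendsto (fun z ↦ D.H n z * kernel N s₀ z) (𝓝[{z : ℂ | z.im < n}] ((x : ℂ) + n * I))
      (𝓝 (D.H n ((x : ℂ) + n * I) * kernel N s₀ ((x : ℂ) + n * I))) :=
    (hH.mul hk).tendsto.mono_left nhdsWithin_le_nhds
  have h3 := h1.mul h2
  refine (h3.congr fun z ↦ ?_)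
  show zetaCpow (D.μ n) (z - n * I) * (D.H n z * kernel N s₀ z) = D.g N s₀ z
  rw [g, D.G_eq_zetaCpow_mul_H hn, mul_assoc]

/-- **Boundary value from above.** [cite: Tenenbaum2015, II.5 §5.1] -/
theorem tendsto_g_upper (hL : 1 ≤ L N) (hσ₀ : σR N < s₀.re) (ht₀ : |s₀.im| < 1)
    (hT : (D.K : ℝ) + 2 ≤ T N) {n : ℤ} (hn : n ∈ D.S) {x : ℝ} (hx : x ∈ Ico (σL D.K N) 1) :
    Tendsto (D.g N s₀) (𝓝[{z : ℂ | (n : ℝ) < z.im}] ((x : ℂ) + ((n : ℝ) : ℂ) * I))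
      (𝓝 (bvUpper D N s₀ n x)) := by
  rw [ofReal_intCast]
  have hxreg : (x : ℂ) ∈ zfrRegion :=
    mem_zfrRegion_of_σL_le (K := D.K) (by simpa using hx.1)
      (by simp; linarith [five_le_Y (K := D.K) hL])
  have hmap : Tendsto (fun z : ℂ ↦ z - n * I) (𝓝[{z : ℂ | (n : ℝ) < z.im}] ((x : ℂ) + n * I))
      (𝓝[{s : ℂ | 0 ≤ s.im}] (x : ℂ)) := by
    refine tendsto_nhdsWithin_of_tendsto_nhds_of_eventually_within _ ?_ ?_
    · have hc : Continuous fun z : ℂ ↦ z - n * I := by fun_prop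
      have := hc.tendsto ((x : ℂ) + n * I)
      rw [show (x : ℂ) + n * I - n * I = x by ring] at this
      exact this.mono_left nhdsWithin_le_nhds
    · filter_upwards [self_mem_nhdsWithin] with z hz
      have hz' : (n : ℝ) < z.im := hz
      show 0 ≤ (z - n * I).im
      simp; linarith
  have h1 := (tendsto_zetaCpow_upper (μ := D.μ n) hxreg hx.2).comp hmap
  have hpt34 : 3 / 4 < ((x : ℂ) + n * I).re := by simp; linarith [hx.1, σL_ge (K := D.K) hL]
  have hother := other_shifts_mem ht₀ hT hn (z := (x : ℂ) + n * I) (by simpa using hx.1) (by simp)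
  have hH : ContinuousAt (D.H n) ((x : ℂ) + n * I) := D.continuousAt_H hother hpt34
  have hne : (x : ℂ) + n * I ≠ s₀ := by
    intro h
    have := congrArg Complex.re h
    simp at this
    linarith [hx.2, one_lt_σR hL]
  have hk : ContinuousAt (kernel N s₀) ((x : ℂ) + n * I) := continuousAt_kernel hne
  have h2 : Tendsto (fun z ↦ D.H n z * kernel N s₀ z) (𝓝[{z : ℂ | (n : ℝ) < z.im}] ((x : ℂ) + n * I))
      (𝓝 (D.H n ((x : ℂ) + n * I) * kernel N s₀ ((x : ℂ) + n * I))) :=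
    (hH.mul hk).tendsto.mono_left nhdsWithin_le_nhds
  have h3 := h1.mul h2
  refine (h3.congr fun z ↦ ?_)
  show zetaCpow (D.μ n) (z - n * I) * (D.H n z * kernel N s₀ z) = D.g N s₀ z
  rw [g, D.G_eq_zetaCpow_mul_H hn, mul_assoc]

/-- The zeta factor near its branch point: for `w` in the region with `|Im w| ≤ 1`, `‖w − 1‖ ≤ 1`,
`w ≠ 1` and `ν ≤ μ̄ ∈ [0, 1]`, `|ν| ≤ 1`:
`‖ζ(w)^ν‖ ≤ (C log 4 + 1) ‖w − 1‖^{−μ̄}`. [cite: Titchmarsh1986, Theorem 3.11] -/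
theorem norm_zetaCpow_le_near {ν μb : ℝ} (hνμ : ν ≤ μb) (hμb0 : 0 ≤ μb)
    (hν : |ν| ≤ 1) {w : ℂ} (hw : w ∈ zfrRegion) (hw1 : w ≠ 1) (him : |w.im| ≤ 1)
    (hnorm : ‖w - 1‖ ≤ 1) :
    ‖zetaCpow ν w‖ ≤ (zfrBoundConst * Real.log 4 + 1) * ‖w - 1‖ ^ (-μb) := by
  set d : ℝ := ‖w - 1‖ with hd
  have hd0 : 0 < d := norm_pos_iff.2 (sub_ne_zero.2 hw1)
  set C₄ : ℝ := zfrBoundConst * Real.log 4 with hC₄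
  have hC₄0 : 0 ≤ C₄ := mul_nonneg zfrBoundConst_pos.le (Real.log_nonneg (by norm_num))
  have hlog : zfrBoundConst * Real.log (|w.im| + 3) ≤ C₄ :=
    mul_le_mul_of_nonneg_left (Real.log_le_log (by linarith [abs_nonneg w.im]) (by linarith))
      zfrBoundConst_pos.le
  have hlog0 : 0 ≤ zfrBoundConst * Real.log (|w.im| + 3) :=
    mul_nonneg zfrBoundConst_pos.le (Real.log_nonneg (by linarith [abs_nonneg w.im]))
  -- `d^{−μ̄} ≥ 1`
  have hdμ : 1 ≤ d ^ (-μb) := Real.one_le_rpow_of_pos_of_le_one_of_nonpos hd0 hnorm (by linarith)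
  rcases le_or_gt 0 ν with h0 | h0
  · -- `‖ζ^ν‖ ≤ (C₄ + 1/d)^ν ≤ ((C₄+1)/d)^ν = (C₄+1)^ν d^{−ν} ≤ (C₄+1) d^{−μ̄}`
    have h1 := norm_zetaCpow_le_of_nonneg h0 hw hw1
    have h2 : zfrBoundConst * Real.log (|w.im| + 3) + 1 / ‖w - 1‖ ≤ (C₄ + 1) / d := by
      rw [add_div, ← hd]
      have : C₄ ≤ C₄ / d := by
        rw [le_div_iff₀ hd0]; nlinarith
      linarith
    have h3 : ‖zetaCpow ν w‖ ≤ ((C₄ + 1) / d) ^ ν :=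
      h1.trans (Real.rpow_le_rpow (by positivity) h2 h0)
    rw [Real.div_rpow (by linarith) hd0.le] at h3
    have h4 : (C₄ + 1) ^ ν ≤ C₄ + 1 := by
      calc (C₄ + 1) ^ ν ≤ (C₄ + 1) ^ (1 : ℝ) :=
            Real.rpow_le_rpow_of_exponent_le (by linarith) ((le_abs_self ν).trans hν)
        _ = C₄ + 1 := Real.rpow_one _
    have h5 : (d ^ ν)⁻¹ ≤ d ^ (-μb) := by
      rw [← Real.rpow_neg hd0.le]
      exact Real.rpow_le_rpow_of_exponent_ge hd0 hnorm (by linarith)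
    calc ‖zetaCpow ν w‖ ≤ (C₄ + 1) ^ ν / d ^ ν := h3
      _ = (C₄ + 1) ^ ν * (d ^ ν)⁻¹ := div_eq_mul_inv _ _
      _ ≤ (C₄ + 1) * d ^ (-μb) :=
          mul_le_mul h4 h5 (inv_nonneg.2 (Real.rpow_nonneg hd0.le _)) (by linarith)
  · -- `‖ζ^ν‖ ≤ (C log)^{−ν} ≤ (C₄+1)^{−ν} ≤ C₄ + 1 ≤ (C₄+1) d^{−μ̄}`
    have h1 := norm_zetaCpow_le_of_nonpos h0.le hw hw1
    have h2 : (zfrBoundConst * Real.log (|w.im| + 3)) ^ (-ν) ≤ (C₄ + 1) ^ (-ν) :=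
      Real.rpow_le_rpow hlog0 (by linarith) (by linarith)
    have h3 : (C₄ + 1) ^ (-ν) ≤ C₄ + 1 := by
      calc (C₄ + 1) ^ (-ν) ≤ (C₄ + 1) ^ (1 : ℝ) :=
            Real.rpow_le_rpow_of_exponent_le (by linarith) ((neg_le_abs ν).trans hν)
        _ = C₄ + 1 := Real.rpow_one _
    calc ‖zetaCpow ν w‖ ≤ C₄ + 1 := h1.trans (h2.trans h3)
      _ = (C₄ + 1) * 1 := (mul_one _).symm
      _ ≤ (C₄ + 1) * d ^ (-μb) := mul_le_mul_of_nonneg_left hdμ (by linarith)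

/-- The thin box around the slit at height `n`. [folklore] -/
def slitBox (D : EulerTwistData) (N : ℕ) (n : ℤ) : Set ℂ :=
  {z : ℂ | σL D.K N ≤ z.re ∧ z.re ≤ 1 + r N ∧ |z.im - n| ≤ r N}

/-- Auxiliary step `slitBox_eq` (see the module docstring). [folklore] -/
theorem slitBox_eq (n : ℤ) :
    slitBox D N n = Icc (σL D.K N) (1 + r N) ×ℂ Icc ((n : ℝ) - r N) ((n : ℝ) + r N) := by
  ext z
  rw [slitBox, mem_setOf_eq, mem_reProdIm, mem_Icc, mem_Icc, abs_le]
  constructor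
  · rintro ⟨h1, h2, h3, h4⟩; exact ⟨⟨h1, h2⟩, by linarith, by linarith⟩
  · rintro ⟨⟨h1, h2⟩, h3, h4⟩; exact ⟨h1, h2, by linarith, by linarith⟩

/-- Auxiliary step `isCompact_slitBox` (see the module docstring). [folklore] -/
theorem isCompact_slitBox (n : ℤ) : IsCompact (slitBox D N n) := by
  rw [slitBox_eq]
  exact Metric.isCompact_of_isClosed_isBounded (isClosed_Icc.reProdIm isClosed_Icc)
    ((Metric.isBounded_Icc _ _).reProdIm (Metric.isBounded_Icc _ _))

/-- On the thin box, the regular factor `H_n · k` is continuous. [folklore] -/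
theorem continuousOn_H_mul_kernel (hL : 1 ≤ L N) (hσ₀ : σR N < s₀.re) (ht₀ : |s₀.im| < 1)
    (hT : (D.K : ℝ) + 2 ≤ T N) {n : ℤ} (hn : n ∈ D.S) :
    ContinuousOn (fun z ↦ D.H n z * kernel N s₀ z) (slitBox D N n) := by
  intro z hz
  obtain ⟨h1, h2, h3⟩ := hz
  have hr := r_le_half hL
  have hH : ContinuousAt (D.H n) z :=
    D.continuousAt_H (other_shifts_mem ht₀ hT hn h1 (by linarith))
      (by linarith [σL_ge (K := D.K) hL])
  have hne : z ≠ s₀ := by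
    intro h; rw [h] at h2; linarith [one_add_r_lt_σR hL]
  exact ((hH.mul (continuousAt_kernel hne)).continuousWithinAt)

/-- **The bound near the branch points**: one constant `C ≥ 0` with
`‖g(z)‖ ≤ C ‖z − (1 + in)‖^{−μ̄}` on every thin box minus its slit. [cite: Tenenbaum2015, II.5 §5.2] -/
theorem exists_bound_near_slits (hL : 1 ≤ L N) (hσ₀ : σR N < s₀.re) (ht₀ : |s₀.im| < 1)
    (hT : (D.K : ℝ) + 2 ≤ T N) :
    ∃ C : ℝ, 0 ≤ C ∧ ∀ n ∈ D.S, ∀ z ∈ slitBox D N n \ {z : ℂ | z.im = n ∧ z.re ≤ 1},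
      ‖D.g N s₀ z‖ ≤ C * ‖z - ((1 : ℂ) + (n : ℂ) * I)‖ ^ (-D.μbar) := by
  set C₄ : ℝ := zfrBoundConst * Real.log 4 + 1 with hC₄
  have hC₄0 : 0 ≤ C₄ := by
    rw [hC₄]; have := zfrBoundConst_pos; have := Real.log_nonneg (by norm_num : (1:ℝ) ≤ 4); positivity
  have hr := r_le_half hL
  have hrpos := r_pos hL
  have hℓ := ℓ_le (K := D.K) hL
  -- per slit
  have hev : ∀ n ∈ D.S, ∀ᶠ C in atTop, ∀ z ∈ slitBox D N n \ {z : ℂ | z.im = n ∧ z.re ≤ 1},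
      ‖D.g N s₀ z‖ ≤ C * ‖z - ((1 : ℂ) + (n : ℂ) * I)‖ ^ (-D.μbar) := by
    intro n hn
    obtain ⟨B, hB⟩ := (isCompact_slitBox (D := D) (N := N) n).exists_bound_of_continuousOn
      (continuousOn_H_mul_kernel hL hσ₀ ht₀ hT hn)
    have hB0 : 0 ≤ B := by
      have hmem : ((1 : ℂ) + n * I) ∈ slitBox D N n := by
        refine ⟨by simp; linarith [σL_lt_one (K := D.K) hL], by simp; linarith, by simp; linarith⟩
      exact (norm_nonneg _).trans (hB _ hmem)
    filter_upwards [eventually_ge_atTop (C₄ * B)] with C hC z hz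
    obtain ⟨⟨hz1, hz2, hz3⟩, hzs⟩ := hz
    set w : ℂ := z - n * I with hw
    have hw1 : w ≠ 1 := by
      intro h
      apply hzs
      have hre := congrArg Complex.re h
      have him := congrArg Complex.im h
      simp [hw] at hre him
      exact ⟨by linarith, by linarith⟩
    have hwreg : w ∈ zfrRegion := by
      refine shift_mem_zfrRegion ht₀ hz1 ?_ hn
      have h1 : |z.im - s₀.im| ≤ |z.im - n| + |(n : ℝ) - s₀.im| := abs_sub_le _ _ _
      have h2 : |(n : ℝ) - s₀.im| ≤ |(n : ℝ)| + |s₀.im| := abs_sub _ _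
      have h3 := D.abs_intCast_le_K hn
      linarith
    have hwim : |w.im| ≤ 1 := by
      have : w.im = z.im - n := by simp [hw]
      rw [this]; linarith
    have hw1eq : w - 1 = z - ((1 : ℂ) + (n : ℂ) * I) := by rw [hw]; ring
    have hwnorm : ‖w - 1‖ ≤ 1 := by
      have h1 : ‖w - 1‖ ≤ |(w - 1).re| + |(w - 1).im| := norm_le_abs_re_add_abs_im _
      have hre : (w - 1).re = z.re - 1 := by simp [hw]
      have him : (w - 1).im = z.im - n := by simp [hw]
      rw [hre, him] at h1
      have h2 : |z.re - 1| ≤ 1 / 2 := by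
        rw [abs_le]; constructor
        · have := one_sub_σL (K := D.K) (N := N); linarith
        · linarith
      linarith
    have hzeta := norm_zetaCpow_le_near (D.le_μbar hn) D.μbar_nonneg
      (D.abs_μ_le_one n) hwreg hw1 hwim hwnorm
    rw [hw1eq] at hzeta
    have hHk := hB z ⟨hz1, hz2, hz3⟩
    rw [g, D.G_eq_zetaCpow_mul_H hn, mul_assoc, norm_mul]
    have hpow0 : 0 ≤ ‖z - ((1 : ℂ) + (n : ℂ) * I)‖ ^ (-D.μbar) := Real.rpow_nonneg (norm_nonneg _) _
    calc ‖zetaCpow (D.μ n) (z - n * I)‖ * ‖D.H n z * kernel N s₀ z‖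
        ≤ (C₄ * ‖z - ((1 : ℂ) + (n : ℂ) * I)‖ ^ (-D.μbar)) * B :=
          mul_le_mul hzeta hHk (norm_nonneg _) (mul_nonneg hC₄0 hpow0)
      _ = (C₄ * B) * ‖z - ((1 : ℂ) + (n : ℂ) * I)‖ ^ (-D.μbar) := by ring
      _ ≤ C * ‖z - ((1 : ℂ) + (n : ℂ) * I)‖ ^ (-D.μbar) := mul_le_mul_of_nonneg_right hC hpow0
  obtain ⟨C, hC0, hC⟩ := ((eventually_ge_atTop (0 : ℝ)).and
    ((Filter.eventually_all_finset D.S).2 hev)).exists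
  exact ⟨C, hC0, hC⟩

/-- The uniform bound for `G` on the contour at distance `≥ η` from the branch points:
`(C log Y + 1/η)^P exp((1+P)R* + 6 log log(2(T+1)+6) + C_A)`. [folklore] -/
def Gbound (D : EulerTwistData) (η : ℝ) (N : ℕ) : ℝ :=
  (zfrBoundConst * Real.log (Y D.K N) + 1 / η) ^ D.P *
    Real.exp ((1 + D.P) * logRemainderBound + (6 * Real.log (Real.log (2 * (T N + 1) + 6)) + D.CA))

/-- Auxiliary step `Gbound_nonneg` (see the module docstring). [folklore] -/
theorem Gbound_nonneg (hL : 1 ≤ L N) {η : ℝ} (hη : 0 < η) : 0 ≤ Gbound D η N := by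
  unfold Gbound
  have := zfrBoundConst_pos; have := log_Y_pos (K := D.K) hL
  exact mul_nonneg (Real.rpow_nonneg (by positivity) _) (Real.exp_pos _).le

/-- **`G` on the contour**: for `z` in the strip `σ_L ≤ Re z ≤ 2`, `|Im z − t₀| ≤ T`, off the branch
points and at distance `≥ η` from them, `‖G(z)‖ ≤ Gbound η`. [cite: Montgomery1983, §3, Lemmas 2–4] -/
theorem norm_G_le_contour (hL : 1 ≤ L N) (ht₀ : |s₀.im| < 1) {z : ℂ} (hre : σL D.K N ≤ z.re)
    (hre2 : z.re ≤ 2) (him : |z.im - s₀.im| ≤ T N) (hz1 : ∀ n ∈ D.S, z - n * I ≠ 1)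
    {η : ℝ} (hη : 0 < η) (hηz : ∀ n ∈ D.S, η ≤ ‖z - n * I - 1‖) :
    ‖D.G z‖ ≤ Gbound D η N := by
  have hzabs : |z.im| ≤ T N + 1 := by
    have := abs_sub_abs_le_abs_sub z.im s₀.im; linarith
  have hreg : ∀ n ∈ D.S, z - n * I ∈ zfrRegion := fun n hn ↦ shift_mem_zfrRegion ht₀ hre him hn
  have hσL := σL_ge (K := D.K) hL
  have hG := D.norm_G_le hreg hz1 (by linarith) hre2
    (by
      refine one_sub_inv_log_le (K := D.K) hre ?_
      unfold Y
      have : (0:ℝ) ≤ D.K := Nat.cast_nonneg _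
      linarith)
    (Λ := Real.log (Y D.K N)) (η := η) (fun n hn ↦ log_shift_le ht₀ him hn) hη hηz
  -- monotonicity in `|Im z| ≤ T + 1` of the log log factor
  have hll : Real.log (Real.log (2 * |z.im| + 6)) ≤ Real.log (Real.log (2 * (T N + 1) + 6)) := by
    have h1 : 1 < 2 * |z.im| + 6 := by linarith [abs_nonneg z.im]
    have h2 : Real.exp 1 ≤ 2 * |z.im| + 6 := by
      have := Real.exp_one_lt_d9; linarith [abs_nonneg z.im]
    have h3 : 1 ≤ Real.log (2 * |z.im| + 6) := by
      rwa [Real.le_log_iff_exp_le (by linarith)]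
    exact Real.log_le_log (by linarith) (Real.log_le_log (by linarith) (by linarith))
  refine hG.trans (mul_le_mul_of_nonneg_left (Real.exp_le_exp.2 (by linarith)) ?_)
  exact Real.rpow_nonneg (by have := zfrBoundConst_pos; have := log_Y_pos (K := D.K) hL; positivity) _

/-- `g` on the left edge `Re z = σ_L`, `|Im z − t₀| ≤ T`:
`‖g‖ ≤ Gbound ℓ · x^{σ_L − σ₀}/(σ₀ − σ_L)`. [folklore] -/
theorem norm_g_left_le (hL : 1 ≤ L N) (hσ₀ : σR N < s₀.re) (ht₀ : |s₀.im| < 1)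
    {y : ℝ} (hy : y ∈ Icc (s₀.im - T N) (s₀.im + T N)) :
    ‖D.g N s₀ ((σL D.K N : ℂ) + y * I)‖ ≤
      Gbound D (ℓ D.K N) N * (xN N ^ (σL D.K N - s₀.re) / (s₀.re - σL D.K N)) := by
  set z : ℂ := (σL D.K N : ℂ) + y * I with hz
  have hzre : z.re = σL D.K N := by simp [hz]
  have hzim : z.im = y := by simp [hz]
  have hyT : |z.im - s₀.im| ≤ T N := by
    rw [hzim, abs_le]; constructor <;> linarith [hy.1, hy.2]
  have hne1 : ∀ n ∈ D.S, z - n * I ≠ 1 := by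
    intro n hn h
    have := congrArg Complex.re h
    simp [hz] at this
    linarith [σL_lt_one (K := D.K) hL]
  have hσL := σL_ge (K := D.K) hL
  have hσL1 := σL_lt_one (K := D.K) hL
  have hℓpos := ℓ_pos (K := D.K) hL
  have hG' := norm_G_le_contour hL ht₀ (le_of_eq hzre.symm) (by rw [hzre]; linarith) hyT hne1 hℓpos
    (by
      intro n hn
      have h1 : |(z - n * I - 1).re| ≤ ‖z - n * I - 1‖ := abs_re_le_norm _
      have h2 : (z - n * I - 1).re = -ℓ D.K N := by simp [hz, σL]
      rw [h2, abs_neg, abs_of_pos hℓpos] at h1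
      exact h1)
  -- the kernel
  have hk : ‖kernel N s₀ z‖ ≤ xN N ^ (σL D.K N - s₀.re) / (s₀.re - σL D.K N) := by
    rw [norm_kernel, hzre]
    have hpos : 0 < s₀.re - σL D.K N := by linarith [one_lt_σR hL]
    refine div_le_div_of_nonneg_left (Real.rpow_nonneg (xN_pos N).le _) hpos ?_
    have h1 : |(z - s₀).re| ≤ ‖z - s₀‖ := abs_re_le_norm _
    have h2 : (z - s₀).re = σL D.K N - s₀.re := by simp [hz]
    rw [h2, abs_of_neg (by linarith)] at h1
    linarith
  rw [g, norm_mul]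
  exact mul_le_mul hG' hk (norm_nonneg _) (Gbound_nonneg hL hℓpos)

/-- `g` is integrable up the left edge (bounded, and continuous off the finitely many slit points).
[folklore] -/
theorem intervalIntegrable_g_left (hL : 1 ≤ L N) (hσ₀ : σR N < s₀.re) (ht₀ : |s₀.im| < 1) :
    IntervalIntegrable (fun y : ℝ ↦ D.g N s₀ ((σL D.K N : ℂ) + (y : ℂ) * I)) volume
      (s₀.im - T N) (s₀.im + T N) := by
  have hcd : s₀.im - T N ≤ s₀.im + T N := by linarith [T_pos hL]
  refine intervalIntegrable_of_bounded_of_continuousOn_diff_finite hcd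
    ((D.S.image (Int.cast : ℤ → ℝ)).finite_toSet) ?_ (fun y hy ↦ norm_g_left_le hL hσ₀ ht₀ hy.1)
  · intro y hy
    have hyS : ∀ n ∈ D.S, y ≠ n := by
      intro n hn h
      exact hy.2 (by simp only [Finset.coe_image, mem_image, Finset.mem_coe]; exact ⟨n, hn, h.symm⟩)
    set z : ℂ := (σL D.K N : ℂ) + y * I with hz
    have hyT : |z.im - s₀.im| ≤ T N := by
      simp only [hz, add_im, ofReal_im, mul_im, ofReal_re, I_im, mul_one, I_re, mul_zero, add_zero,
        zero_add, abs_le]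
      constructor <;> linarith [hy.1.1, hy.1.2]
    have hslit : z ∈ shiftedSlitDomain D.S := by
      intro n hn
      refine mem_zfrSlitRegion_of_im_ne_zero
        (shift_mem_zfrRegion ht₀ (by simp [hz]) hyT hn) ?_
      simp [hz, sub_eq_zero]
      exact hyS n hn
    have h34 : 3 / 4 < z.re := by simp [hz]; linarith [σL_ge (K := D.K) hL]
    have hG : ContinuousAt D.G z :=
      (D.differentiableOn_G.differentiableAt
        (((isOpen_shiftedSlitDomain D.S).inter (isOpen_lt continuous_const continuous_re)).mem_nhds
          ⟨hslit, h34⟩)).continuousAt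
    have hne : z ≠ s₀ := by
      intro h; have := congrArg Complex.re h; simp [hz] at this
      linarith [σL_lt_one (K := D.K) hL, one_lt_σR hL]
    have hg : ContinuousAt (D.g N s₀) z := hG.mul (continuousAt_kernel hne)
    have hpath : ContinuousAt (fun y : ℝ ↦ (σL D.K N : ℂ) + (y : ℂ) * I) y := by fun_prop
    exact (ContinuousAt.comp_of_eq hg hpath rfl).continuousWithinAt

/-- **The contour collapsed onto the slits**:
`∮_{∂R} g = Σ_{n ∈ S} cut_n` for `R = [σ_L, σ_R] × [t₀ − T, t₀ + T]`.
[cite: Montgomery1983, §4 ("we replace the path of integration by … loops Γ_k")] -/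
theorem rectBoundaryIntegral_eq_sum_cut (hL : 1 ≤ L N) (hσ₀ : σR N < s₀.re) (ht₀ : |s₀.im| < 1)
    (hT : (D.K : ℝ) + 2 ≤ T N) :
    rectBoundaryIntegral (D.g N s₀) (σL D.K N) (σR N) (s₀.im - T N) (s₀.im + T N) =
      ∑ n ∈ D.S, cut D N s₀ n := by
  obtain ⟨C, hC0, hC⟩ := exists_bound_near_slits hL hσ₀ ht₀ hT
  have hr := r_pos hL
  have hr2 := r_le_half hL
  have hT1 := one_le_T hL
  have key := rectBoundaryIntegral_eq_sum_slitIntegral (D.S.image (Int.cast : ℤ → ℝ))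
    (F := D.g N s₀) (a := σL D.K N) (b := σR N) (ξ := 1) (r := r N) (C := C) (μ := D.μbar)
    (σL_lt_one hL) hr (one_add_r_lt_σR hL).le D.μbar_lt_one hC0
    (Fm := fun h x ↦ bvLower D N s₀ ⌊h⌋ x) (Fp := fun h x ↦ bvUpper D N s₀ ⌊h⌋ x)
    (c := s₀.im - T N) (d := s₀.im + T N) (U := U D s₀)
    ?_ ?_ ?_ ?_ ?_ (by linarith) (rect_subset_U hL hσ₀ ht₀) differentiableOn_g
    (intervalIntegrable_g_left hL hσ₀ ht₀)
  · rw [key, Finset.sum_image fun a _ b _ h ↦ Int.cast_injective h]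
    refine Finset.sum_congr rfl fun n _ ↦ ?_
    simp only [Int.floor_intCast]
    rfl
  · -- separation of the slits
    intro h hh h' hh' hlt
    simp only [Finset.mem_image] at hh hh'
    obtain ⟨n, -, rfl⟩ := hh
    obtain ⟨n', -, rfl⟩ := hh'
    have : n < n' := by exact_mod_cast hlt
    have : (n : ℝ) + 1 ≤ n' := by exact_mod_cast this
    linarith
  · -- the bound near the branch points
    intro h hh z hz
    simp only [Finset.mem_image] at hh
    obtain ⟨n, hn, rfl⟩ := hh
    have := hC n hn z (by
      refine ⟨⟨hz.1.1, hz.1.2.1, hz.1.2.2⟩, fun h' ↦ hz.2 ?_⟩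
      exact ⟨h'.1, h'.2⟩)
    simpa using this
  · -- lower boundary values
    intro h hh x hx
    simp only [Finset.mem_image] at hh
    obtain ⟨n, hn, rfl⟩ := hh
    simp only [Int.floor_intCast]
    exact tendsto_g_lower hL hσ₀ ht₀ hT hn hx
  · -- upper boundary values
    intro h hh x hx
    simp only [Finset.mem_image] at hh
    obtain ⟨n, hn, rfl⟩ := hh
    simp only [Int.floor_intCast]
    exact tendsto_g_upper hL hσ₀ ht₀ hT hn hx
  · -- the slits are well inside the rectangle
    intro h hh
    simp only [Finset.mem_image] at hh
    obtain ⟨n, hn, rfl⟩ := hh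
    have h1 := D.abs_intCast_le_K hn
    have h2 := abs_lt.1 ht₀
    have h3 := abs_le.1 h1
    constructor <;> linarith

/-! ## The rim difference as a Laplace integral -/

/-- The amplitude `q_n(u) = ‖ζ₁(1−u)‖^{μ_n} H_n(1 − u + in)/(1 − u + in − s₀)` of the cut integral.
[cite: Montgomery1983, §4 (22)–(23)] -/
def q (D : EulerTwistData) (s₀ : ℂ) (n : ℤ) (u : ℝ) : ℂ :=
  ((‖riemannZeta₁ ((1 - u : ℝ) : ℂ)‖ ^ (D.μ n) : ℝ) : ℂ) * D.H n (((1 - u : ℝ) : ℂ) + n * I) /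
    ((((1 - u : ℝ) : ℂ) + n * I) - s₀)

/-- `e^{iθ} − e^{−iθ} = 2i sin θ`. [folklore] -/
theorem exp_mul_I_sub_exp_neg (θ : ℝ) :
    exp ((θ : ℂ) * I) - exp (-(θ : ℂ) * I) = 2 * I * (Real.sin θ : ℂ) := by
  rw [ofReal_sin, Complex.sin]
  have hI : I * I = -1 := I_mul_I
  rw [show -(θ : ℂ) * I = -((θ : ℂ) * I) by ring]
  field_simp
  ring_nf
  rw [I_sq]
  ring

/-- The two rims differ by the factor `2i sin(πμ_n)`:
`g₋(x) − g₊(x) = 2i sin(πμ_n) ‖ζ₁ x‖^{μ_n}(1−x)^{−μ_n} H_n(x+in) k(x+in)`. [cite: Tenenbaum2015, II.5 §5.2] -/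
theorem bvLower_sub_bvUpper (n : ℤ) (x : ℝ) :
    bvLower D N s₀ n x - bvUpper D N s₀ n x =
      2 * I * (Real.sin (Real.pi * D.μ n) : ℂ) *
        ((((‖riemannZeta₁ x‖ ^ (D.μ n) * (1 - x) ^ (-(D.μ n)) : ℝ) : ℂ)) *
          (D.H n (x + n * I) * kernel N s₀ (x + n * I))) := by
  rw [bvLower, bvUpper, ← sub_mul, ← mul_sub, ← exp_mul_I_sub_exp_neg]
  push_cast
  ring

/-- The rims are integrable along the slit. [folklore] -/
theorem intervalIntegrable_bv (hL : 1 ≤ L N) (hσ₀ : σR N < s₀.re) (ht₀ : |s₀.im| < 1)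
    (hT : (D.K : ℝ) + 2 ≤ T N) {n : ℤ} (hn : n ∈ D.S) (ε : ℝ) :
    IntervalIntegrable (fun x : ℝ ↦
      (((‖riemannZeta₁ x‖ ^ (D.μ n) * (1 - x) ^ (-(D.μ n)) : ℝ) : ℂ) * exp ((ε : ℂ) * I)) *
        (D.H n (x + n * I) * kernel N s₀ (x + n * I))) volume (σL D.K N) 1 := by
  have hσL1 := σL_lt_one (K := D.K) hL
  -- the singular weight `(1 − x)^{−μ}`
  have h1 : IntervalIntegrable (fun x : ℝ ↦ (((1 - x) ^ (-(D.μ n)) : ℝ) : ℂ)) volume (σL D.K N) 1 := by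
    have h := (intervalIntegral.intervalIntegrable_rpow' (a := 1 - σL D.K N) (b := 1 - 1)
      (by linarith [D.μ_lt_one n] : -1 < -(D.μ n))).comp_sub_left 1
    have h' : IntervalIntegrable (fun x : ℝ ↦ (1 - x) ^ (-(D.μ n))) volume (σL D.K N) 1 := by
      simpa using h
    exact ⟨h'.1.ofReal, h'.2.ofReal⟩
  -- the continuous rest
  have h2 : ContinuousOn (fun x : ℝ ↦ ((‖riemannZeta₁ x‖ ^ (D.μ n) : ℝ) : ℂ) * exp ((ε : ℂ) * I) *
      (D.H n (x + n * I) * kernel N s₀ (x + n * I))) (uIcc (σL D.K N) 1) := by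
    rw [uIcc_of_le hσL1.le]
    intro x hx
    have hxreg : (x : ℂ) ∈ zfrRegion :=
      mem_zfrRegion_of_σL_le (K := D.K) (by simpa using hx.1) (by simp; linarith [five_le_Y (K := D.K) hL])
    have hz : ContinuousAt (fun x : ℝ ↦ ((‖riemannZeta₁ x‖ ^ (D.μ n) : ℝ) : ℂ)) x := by
      have hc : ContinuousAt (fun x : ℝ ↦ ‖riemannZeta₁ x‖) x :=
        (differentiable_riemannZeta₁.continuous.continuousAt.comp continuous_ofReal.continuousAt).norm
      exact continuous_ofReal.continuousAt.comp
        (hc.rpow_const (Or.inl (norm_ne_zero_iff.2 (riemannZeta₁_ne_zero_of_mem_zfrRegion hxreg))))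
    have hpt34 : 3 / 4 < ((x : ℂ) + n * I).re := by simp; linarith [hx.1, σL_ge (K := D.K) hL]
    have hother := other_shifts_mem ht₀ hT hn (z := (x : ℂ) + n * I) (by simpa using hx.1) (by simp)
    have hH : ContinuousAt (D.H n) ((x : ℂ) + n * I) := D.continuousAt_H hother hpt34
    have hne : (x : ℂ) + n * I ≠ s₀ := by
      intro h; have := congrArg Complex.re h; simp at this
      linarith [hx.2, one_lt_σR hL]
    have hk : ContinuousAt (kernel N s₀) ((x : ℂ) + n * I) := continuousAt_kernel hne
    have hpath : ContinuousAt (fun x : ℝ ↦ (x : ℂ) + n * I) x := by fun_prop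
    have hHk : ContinuousAt (fun x : ℝ ↦ D.H n (x + n * I) * kernel N s₀ (x + n * I)) x :=
      (ContinuousAt.comp_of_eq hH hpath rfl).mul (ContinuousAt.comp_of_eq hk hpath rfl)
    exact ((hz.mul continuousAt_const).mul hHk).continuousWithinAt
  have h3 := h1.mul_continuousOn h2
  refine h3.congr fun x _ ↦ ?_
  push_cast
  ring

/-- **The rim difference is a Laplace integral with an algebraic endpoint singularity**:
`cut_n = 2i sin(πμ_n) x^{1+in−s₀} ∫_0^ℓ u^{−μ_n} e^{−L'u} q_n(u) du`.
[cite: Montgomery1983, §4 (22)–(23)] -/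
theorem cut_eq (hL : 1 ≤ L N) (hσ₀ : σR N < s₀.re) (ht₀ : |s₀.im| < 1)
    (hT : (D.K : ℝ) + 2 ≤ T N) {n : ℤ} (hn : n ∈ D.S) :
    cut D N s₀ n = 2 * I * (Real.sin (Real.pi * D.μ n) : ℂ) * (xN N : ℂ) ^ ((1 + n * I) - s₀) *
      ∫ u in Ioc 0 (ℓ D.K N), ((u ^ (-(D.μ n)) * Real.exp (-(L N * u)) : ℝ) : ℂ) * q D s₀ n u := by
  have hℓ := ℓ_pos (K := D.K) hL
  have hx0 := xN_pos N
  -- combine the two rims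
  have hint_l := intervalIntegrable_bv hL hσ₀ ht₀ hT hn (Real.pi * D.μ n)
  have hint_u := intervalIntegrable_bv hL hσ₀ ht₀ hT hn (-(Real.pi * D.μ n))
  have e1 : cut D N s₀ n = ∫ x in σL D.K N..1, (bvLower D N s₀ n x - bvUpper D N s₀ n x) := by
    rw [cut, ← intervalIntegral.integral_sub]
    · exact hint_l.congr fun x _ ↦ by simp only [bvLower]; push_cast; ring_nf
    · exact hint_u.congr fun x _ ↦ by simp only [bvUpper]; push_cast; ring_nf
  rw [e1]
  -- substitute `x = 1 − u`
  have e2 : (∫ x in σL D.K N..1, (bvLower D N s₀ n x - bvUpper D N s₀ n x)) =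
      ∫ u in (0:ℝ)..ℓ D.K N, (bvLower D N s₀ n (1 - u) - bvUpper D N s₀ n (1 - u)) := by
    rw [intervalIntegral.integral_comp_sub_left (fun x ↦ bvLower D N s₀ n x - bvUpper D N s₀ n x) 1]
    simp [σL]
  rw [e2, intervalIntegral.integral_of_le hℓ.le, ← MeasureTheory.integral_const_mul]
  refine setIntegral_congr_fun measurableSet_Ioc fun u hu ↦ ?_
  have hu0 : 0 < u := hu.1
  rw [bvLower_sub_bvUpper]
  -- the power of `x`
  have hxpow : (xN N : ℂ) ^ ((((1 - u : ℝ) : ℂ) + n * I) - s₀) =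
      (xN N : ℂ) ^ ((1 + n * I) - s₀) * ((Real.exp (-(L N * u)) : ℝ) : ℂ) := by
    have h1 : (((1 - u : ℝ) : ℂ) + n * I) - s₀ = ((1 + n * I) - s₀) + ((-u : ℝ) : ℂ) := by
      push_cast; ring
    rw [h1, cpow_add _ _ (xN_ne_zero N)]
    congr 1
    rw [← ofReal_cpow hx0.le, Real.rpow_def_of_pos hx0,
      show Real.log (xN N) * -u = -(L N * u) by simp only [L]; ring]
  simp only [q, kernel]
  rw [hxpow]
  have hsub : (1 - (1 - u) : ℝ) = u := by ring
  rw [hsub]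
  push_cast
  ring

/-! ## Perron's formula and the right edge -/

/-- The integral of `g` up the right edge `Re s = σ_R`. [cite: Montgomery1983, §2 (5)] -/
def right (D : EulerTwistData) (N : ℕ) (s₀ : ℂ) : ℂ :=
  ∫ y in (s₀.im - T N)..(s₀.im + T N), D.g N s₀ ((σR N : ℂ) + y * I)

/-- **Perron's formula in contour form**:
`‖right + 2π(F(s₀) − F_N(s₀))‖ ≤ x^{σ_R − σ₀} (2/T) (6(1 + log(N+1)) + 2(L' + 1))`.
[cite: Montgomery1983, §2 (5) and §4 (20)] [cite: MontgomeryVaughan2007, Thm. 5.2, Cor. 5.3] -/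
theorem norm_right_add_le (hN : 1 ≤ N) (hL : 1 ≤ L N) (hσ₀ : σR N < s₀.re) :
    ‖right D N s₀ + 2 * Real.pi * (LSeries (D.f ·) s₀ - twistedPartialSum (D.f ·) N s₀)‖ ≤
      xN N ^ (σR N - s₀.re) * (2 / T N) * (6 * (1 + Real.log (N + 1)) + 2 * (L N + 1)) := by
  set α : ℝ := σR N - s₀.re with hα
  have hα0 : α < 0 := by rw [hα]; linarith
  have hσ : 1 < s₀.re + α := by rw [hα]; have := one_lt_σR hL; linarith
  have hT := T_pos hL
  have hP := norm_perron_left_add_le (a := (D.f ·)) D.norm_f_le (s := s₀) hα0 hσ N hT hT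
  -- identify the Perron integral with `right`
  have hint : (∫ u in (-T N)..T N, LSeries (D.f ·) (s₀ + α + u * I) *
      ((((N : ℝ) + 1 / 2 : ℝ) : ℂ) ^ ((α : ℂ) + u * I) / ((α : ℂ) + u * I))) = right D N s₀ := by
    have hpt : ∀ u : ℝ, s₀ + α + u * I = (σR N : ℂ) + ((u + s₀.im : ℝ) : ℂ) * I := by
      intro u
      apply Complex.ext
      · simp [hα]
      · simp; ring
    have hsub : ∀ u : ℝ, ((σR N : ℂ) + ((u + s₀.im : ℝ) : ℂ) * I) - s₀ = (α : ℂ) + u * I := by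
      intro u
      apply Complex.ext
      · simp [hα]
      · simp
    have hfun : ∀ u : ℝ, LSeries (D.f ·) (s₀ + α + u * I) *
        ((((N : ℝ) + 1 / 2 : ℝ) : ℂ) ^ ((α : ℂ) + u * I) / ((α : ℂ) + u * I)) =
        D.g N s₀ ((σR N : ℂ) + ((u + s₀.im : ℝ) : ℂ) * I) := by
      intro u
      rw [hpt u, D.LSeries_eq_G (by simp; exact one_lt_σR hL), g, kernel, hsub u]
      rfl
    simp_rw [hfun]
    rw [intervalIntegral.integral_comp_add_right (fun y : ℝ ↦ D.g N s₀ ((σR N : ℂ) + (y : ℂ) * I)) s₀.im,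
      right]
    congr 1 <;> ring
  rw [hint] at hP
  have hsum : (∑ n ∈ Finset.Icc 1 N, D.f n * (n : ℂ) ^ (-s₀)) = twistedPartialSum (D.f ·) N s₀ := rfl
  rw [hsum] at hP
  refine hP.trans ?_
  have hW := (tsum_perronWeight_le hN (ρ := s₀.re + α) hσ).2
  have hρ : s₀.re + α = σR N := by rw [hα]; ring
  rw [hρ] at hW
  have hρ' : σR N / (σR N - 1) = L N + 1 := by
    rw [σR_eq]
    have hL0 : (L N) ≠ 0 := by linarith
    field_simp
    ring
  rw [hρ'] at hW
  push_cast at hW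
  rw [hρ]
  have h2T : 1 / T N + 1 / T N = 2 / T N := by ring
  rw [h2T]
  exact mul_le_mul_of_nonneg_left hW
    (mul_nonneg (Real.rpow_nonneg (xN_pos N).le _) (div_nonneg zero_le_two hT.le))

/-! ## The exact decomposition -/

/-- The integral of `g` along the bottom edge. [folklore] -/
def bottom (D : EulerTwistData) (N : ℕ) (s₀ : ℂ) : ℂ :=
  ∫ x in σL D.K N..σR N, D.g N s₀ (x + (s₀.im - T N : ℝ) * I)

/-- The integral of `g` along the top edge. [folklore] -/
def top (D : EulerTwistData) (N : ℕ) (s₀ : ℂ) : ℂ :=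
  ∫ x in σL D.K N..σR N, D.g N s₀ (x + (s₀.im + T N : ℝ) * I)

/-- The integral of `g` up the left edge. [folklore] -/
def left (D : EulerTwistData) (N : ℕ) (s₀ : ℂ) : ℂ :=
  ∫ y in (s₀.im - T N)..(s₀.im + T N), D.g N s₀ ((σL D.K N : ℂ) + y * I)

/-- The right edge in terms of the others and the cuts:
`right = −i Σ_n cut_n + i·bottom − i·top + left`. [cite: Montgomery1983, §4 (21)] -/
theorem right_eq (hL : 1 ≤ L N) (hσ₀ : σR N < s₀.re) (ht₀ : |s₀.im| < 1)
    (hT : (D.K : ℝ) + 2 ≤ T N) :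
    right D N s₀ = -I * (∑ n ∈ D.S, cut D N s₀ n) + I * bottom D N s₀ - I * top D N s₀ + left D N s₀ := by
  have key := rectBoundaryIntegral_eq_sum_cut hL hσ₀ ht₀ hT
  rw [rectBoundaryIntegral] at key
  have hb : (∫ x : ℝ in σL D.K N..σR N, D.g N s₀ (↑x + ↑(s₀.im - T N) * I)) = bottom D N s₀ := rfl
  have ht : (∫ x : ℝ in σL D.K N..σR N, D.g N s₀ (↑x + ↑(s₀.im + T N) * I)) = top D N s₀ := rfl
  have hr : (∫ y : ℝ in (s₀.im - T N)..(s₀.im + T N), D.g N s₀ (↑(σR N) + ↑y * I)) = right D N s₀ := rfl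
  have hl : (∫ y : ℝ in (s₀.im - T N)..(s₀.im + T N), D.g N s₀ (↑(σL D.K N) + ↑y * I)) = left D N s₀ := rfl
  rw [hb, ht, hr, hl] at key
  -- `bottom − top + I right − I left = Σ cut`
  have : I * right D N s₀ = (∑ n ∈ D.S, cut D N s₀ n) - bottom D N s₀ + top D N s₀ + I * left D N s₀ := by
    rw [← key]; ring
  calc right D N s₀ = -I * (I * right D N s₀) := by rw [← mul_assoc, show -I * I = 1 by rw [neg_mul, I_mul_I, neg_neg], one_mul]
    _ = _ := by rw [this]; ring_nf; rw [I_sq]; ring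

/-- **The exact decomposition of the twisted section** (Montgomery's (20)–(21) for the datum):
`‖(F_N(s₀) − F(s₀)) − (1/2π)(−i Σ_n cut_n + i·bottom − i·top + left)‖
   ≤ (1/2π) x^{σ_R−σ₀} (2/T) (6(1 + log(N+1)) + 2(L'+1))`.
[cite: Montgomery1983, §4 (20)–(21)] -/
theorem norm_sub_decomposition_le (hN : 1 ≤ N) (hL : 1 ≤ L N) (hσ₀ : σR N < s₀.re)
    (ht₀ : |s₀.im| < 1) (hT : (D.K : ℝ) + 2 ≤ T N) :
    ‖(twistedPartialSum (D.f ·) N s₀ - LSeries (D.f ·) s₀) -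
        (1 / (2 * Real.pi) : ℂ) * (-I * (∑ n ∈ D.S, cut D N s₀ n) + I * bottom D N s₀ -
          I * top D N s₀ + left D N s₀)‖ ≤
      1 / (2 * Real.pi) * (xN N ^ (σR N - s₀.re) * (2 / T N) *
        (6 * (1 + Real.log (N + 1)) + 2 * (L N + 1))) := by
  have h1 := norm_right_add_le hN hL hσ₀ (D := D) (s₀ := s₀)
  rw [right_eq hL hσ₀ ht₀ hT] at h1
  have hπ : (2 * Real.pi : ℂ) ≠ 0 := by
    exact_mod_cast (by positivity : (2 * Real.pi : ℝ) ≠ 0)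
  have e : (twistedPartialSum (D.f ·) N s₀ - LSeries (D.f ·) s₀) -
      (1 / (2 * Real.pi) : ℂ) * (-I * (∑ n ∈ D.S, cut D N s₀ n) + I * bottom D N s₀ -
        I * top D N s₀ + left D N s₀) =
      -(1 / (2 * Real.pi) : ℂ) * ((-I * (∑ n ∈ D.S, cut D N s₀ n) + I * bottom D N s₀ -
        I * top D N s₀ + left D N s₀) +
        2 * Real.pi * (LSeries (D.f ·) s₀ - twistedPartialSum (D.f ·) N s₀)) := by
    field_simp
    ring
  rw [e, norm_mul, norm_neg]
  have hn : ‖(1 / (2 * Real.pi) : ℂ)‖ = 1 / (2 * Real.pi) := by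
    rw [show (1 / (2 * Real.pi) : ℂ) = ((1 / (2 * Real.pi) : ℝ) : ℂ) by push_cast; ring]
    rw [norm_real, Real.norm_eq_abs, abs_of_pos (by positivity)]
  rw [hn]
  exact mul_le_mul_of_nonneg_left h1 (by positivity)

end Slits

end EulerTwistData

end Literature.Barriers.RiemannHypothesis

end
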